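import Literature.NumberTheory.ModularSymbols.FullLevelHomologySpreadLattice
import Literature.NumberTheory.EllipticCurves.Gamma1PeriodLatticeTwistProofs
import HarnessLib

/-!
# The quadratic twisting operator `T_χ = Σ_u χ(u)·[1 u/p; 0 1]_*` on `H₁(X₀(N), ℤ)` (`p² ∣ N`) as an
# operator, its base change to `H(N; R)`, and its reading on period classes `Per_f ∘ T_χ = g(χ)·Per_{f_χ}`

Topic `Literature/NumberTheory/ModularSymbols`; namespace `Literature.NumberTheory.ModularSymbols`; sequel of
`CuspidalHomologyHeckeModule` (`periodHomologyHecke`, `symbolInt`, `symbol`, `periodMap`), `FullLevelHomologySpreadLattice`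
(`periodMapLattice`, `periodClassK`) and the tree's twisting formula `gaussSum_mul_cuspSymbol_charTwist`
(`Gamma1PeriodLatticeTwistProofs`, Stevens (5.5)).  Definitions with bodies + proved theorems; no named fact, no `sorry`,
no instance, no notation.

For a prime `p` with `p² ∣ N` and `χ` the primitive quadratic character mod `p` (`g(χ)` its Gauss sum, `h ↦ h_χ :=
charTwist N _ _ _ h` the twist on `S₂(Γ₀(N))`), the transpose of `h ↦ g(χ)·h_χ = Σ_u χ(u) h∣[1 u/p; 0 1]` preserves the
period homology `Λ = H₁(X₀(N), ℤ) ⊆ S₂(Γ₀(N))^∨` (Shimura's matrices: `{∞, a/c + u/p}_h = {∞, γ'_u∞}_h`).  This file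
turns that into honest OPERATORS of the tree (the Summits-side helper
`TeichmullerTwistDescentTwistOperatorPeriodHomology` only produced the image element existentially):

* `quadInt χ u ∈ ℤ` (the value of the quadratic character as an integer), `cast_quadInt`, `quadInt_smul`;
* `exists_twist`, `twist_unique`; **`twistDown N hpN hχ hprim : Λ →ₗ[ℤ] Λ`**, characterised by
  **`coe_twistDown_apply`**: `(T_χ φ)(h) = g(χ)·φ(h_χ)` for all `h`; `twistDown_symbolInt_of_entry_eq_zero`;
  **`twistDown_symbolInt_eq_sum`**: if `X_u ∈ Γ₀(N)` (`u mod p`) have cusps `X_u∞ ≡ γ∞ + u/p (mod ℤ)`, then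
  `T_χ{∞, γ∞} = Σ_u χ(u)·{∞, X_u∞}` (ANY such matrices — the up/down comparison of the sequel supplies its own);
* **`twistDownK N hpN hχ hprim R : H(N; R) →ₗ[R] H(N; R)`** (base change), `twistDownK_tmul`, `twistDownK_symbol_eq_sum`;
* period side: **`gaussMulLattice f : Λ_{f_χ} →ₗ[ℤ] Λ_f`**, `w ↦ g(χ)·w` (well defined by the tree's
  `g(χ)Λ(f_χ) ⊆ Λ(f)`), **`periodMapLattice_twistDown`** (`Per_f(T_χ φ) = g(χ)·Per_{f_χ}(φ)`) and its base change
  **`periodClassK_twistDownK`**: `periodClassK f ∘ T_χ = (1 ⊗ g(χ)·) ∘ periodClassK f_χ` on `H(N; R)`.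

Consumer: `FullLevelHomologyTwistComparison` (the up/down dictionary intertwines `M_θ ∘ T_θ^{up}` on
`H₁(Γ₀(M), k[GL₂(ℤ/p)])^{T̃}` with `twistDownK` on `H(p²M; k)`), K-line of route BSD/TeichmullerTwistDescent (crux
`TwistedPeriodLatticeSaturation`, datum field (D5)).  Nothing about any elliptic curve is asserted.

## References
* G. Shimura, *Introduction to the arithmetic theory of automorphic functions* (1971), Prop. 3.64. [Shimura1971]
* G. Stevens, Invent. Math. 98 (1989), Lemma (5.4) and (5.5), p. 97. [Stevens1989]
* B. Mazur, J. Tate, J. Teitelbaum, Invent. Math. 84 (1986), §I.8. [MazurTateTeitelbaum1986]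
* J. E. Cremona, *Algorithms for modular elliptic curves* (1997), §2.8, §2.10. [CremonaAlgorithms1997]
-/

noncomputable section

namespace Literature.NumberTheory.ModularSymbols

open scoped MatrixGroups TensorProduct ModularForm
open CongruenceSubgroup
open Literature.NumberTheory.EllipticCurves.ModularForms

/-! ### Integer values of a quadratic character -/

section QuadInt

variable {p : ℕ} (χ : DirichletCharacter ℂ p)

open Classical in
/-- The value `χ(u) ∈ {0, 1, −1}` of a quadratic character, as an integer. [cite: Stevens1989, (5.5) p. 97] -/
def quadInt (u : ZMod p) : ℤ := if χ u = 1 then 1 else if χ u = -1 then -1 else 0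

/-- `(quadInt χ u : ℂ) = χ(u)` for a quadratic `χ`. [cite: Stevens1989, (5.5) p. 97] -/
theorem cast_quadInt (hχ : χ.IsQuadratic) (u : ZMod p) : (quadInt χ u : ℂ) = χ u := by
  unfold quadInt
  rcases hχ u with h | h | h
  · rw [h]
    have h1 : ¬ (0 : ℂ) = 1 := by norm_num
    have h2 : ¬ (0 : ℂ) = -1 := by norm_num
    simp [h1, h2]
  · simp [h]
  · rw [h]
    have h1 : ¬ (-1 : ℂ) = 1 := by norm_num
    simp [h1]

/-- `quadInt χ u • x = χ(u) • x` in a `ℂ`-module. [cite: Stevens1989, (5.5) p. 97] -/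
theorem quadInt_smul (hχ : χ.IsQuadratic) {V : Type*} [AddCommGroup V] [Module ℂ V] (u : ZMod p) (x : V) :
    (quadInt χ u : ℤ) • x = χ u • x := by
  rw [← cast_quadInt χ hχ u, Int.cast_smul_eq_zsmul]

end QuadInt

/-! ### The twisting operator on `Λ = H₁(X₀(N), ℤ)` -/

section TwistDown

variable (N : ℕ) [NeZero N] {p : ℕ} [hp : Fact p.Prime] (hpN : p ^ 2 ∣ N)
  {χ : DirichletCharacter ℂ p} (hχ : χ.IsQuadratic) (hprim : χ.IsPrimitive)

include hprim in
/-- **`T_χ` preserves `Λ`**: for `φ ∈ Λ` there is `ψ ∈ Λ` with `ψ(h) = g(χ)·φ(h_χ)` for all `h`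
(`φ = {∞, γ∞}`; for `c ≠ 0` take `ψ = Σ_u χ(u){∞, γ'_u∞}` with Shimura's matrices, `a'_u/c = a/c + u/p`).
[cite: Shimura1971, Prop. 3.64; Stevens1989, Lemma (5.4) p. 97] -/
theorem exists_twist (φ : periodHomologyHecke N) :
    ∃ ψ : periodHomologyHecke N, ∀ h : CuspForm (Gamma0 N) 2,
      (ψ : Module.Dual ℂ (CuspForm (Gamma0 N) 2)) h =
        gaussSum χ (ZMod.stdAddChar (N := p)) * (φ : Module.Dual ℂ (CuspForm (Gamma0 N) 2)) (charTwist N dvd_rfl hpN hχ h) := by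
  obtain ⟨γ, rfl⟩ := symbolInt_surjective N φ
  by_cases hc0 : (γ : SL(2, ℤ)) 1 0 = 0
  · refine ⟨0, fun h => ?_⟩
    rw [symbolInt_apply, cuspSymbol, if_pos hc0, mul_zero]
    rfl
  · have hsq : ((p : ℤ) ^ 2) ∣ (γ : SL(2, ℤ)) 1 0 := sq_dvd_entry_of_mem_Gamma0 hpN γ.2
    choose g hg10 _hg11 hgdiv using
      fun u : ZMod p => exists_sl2_div_eq_div_add_twistShift (γ : SL(2, ℤ)) hsq hc0 u
    have hmem : ∀ u : ZMod p, g u ∈ Gamma0 N := fun u => mem_Gamma0_of_entry_eq (dvd_refl N) γ.2 (hg10 u)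
    refine ⟨∑ u : ZMod p, quadInt χ u • symbolInt N ⟨g u, hmem u⟩, fun h => ?_⟩
    rw [symbolInt_apply, gaussSum_mul_cuspSymbol_charTwist N dvd_rfl hpN hχ hprim h γ hc0, Submodule.coe_sum,
      LinearMap.sum_apply]
    refine Finset.sum_congr rfl fun u _ => ?_
    rw [Submodule.coe_smul_of_tower, LinearMap.smul_apply, symbolInt_apply, quadInt_smul χ hχ, smul_eq_mul]
    congr 1
    have hc0' : (g u) 1 0 ≠ 0 := by rw [hg10 u]; exact hc0
    rw [cuspSymbol, if_neg hc0', hgdiv u]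

/-- An element of `Λ ⊆ S₂^∨` is determined by its values. [cite: CremonaAlgorithms1997, §2.1 (2.1.1)] -/
theorem twist_unique {ψ₁ ψ₂ : periodHomologyHecke N}
    (h : ∀ h : CuspForm (Gamma0 N) 2, (ψ₁ : Module.Dual ℂ (CuspForm (Gamma0 N) 2)) h =
      (ψ₂ : Module.Dual ℂ (CuspForm (Gamma0 N) 2)) h) : ψ₁ = ψ₂ :=
  Subtype.ext (LinearMap.ext h)

/-- The raw twisting map (choice). [cite: Stevens1989, Lemma (5.4) p. 97] -/
def twistDownFun (φ : periodHomologyHecke N) : periodHomologyHecke N :=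
  Classical.choose (exists_twist N hpN hχ hprim φ)

/-- The defining property of `twistDownFun`. [cite: Stevens1989, Lemma (5.4) p. 97] -/
theorem coe_twistDownFun_apply (φ : periodHomologyHecke N) (h : CuspForm (Gamma0 N) 2) :
    (twistDownFun N hpN hχ hprim φ : Module.Dual ℂ (CuspForm (Gamma0 N) 2)) h =
      gaussSum χ (ZMod.stdAddChar (N := p)) * (φ : Module.Dual ℂ (CuspForm (Gamma0 N) 2)) (charTwist N dvd_rfl hpN hχ h) :=
  Classical.choose_spec (exists_twist N hpN hχ hprim φ) h

/-- **The twisting operator `T_χ` on `Λ = H₁(X₀(N), ℤ)`** (`p² ∣ N`, `χ` quadratic primitive mod `p`): the `ℤ`-linear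
endomorphism with `(T_χ φ)(h) = g(χ)·φ(h_χ)`, i.e. the transpose of `h ↦ Σ_u χ(u) h∣[1 u/p; 0 1]`; on modular symbols
`T_χ{α, β} = Σ_u χ(u){α + u/p, β + u/p}`. [cite: MazurTateTeitelbaum1986, §I.8; Stevens1989, Lemma (5.4) p. 97] -/
def twistDown : periodHomologyHecke N →ₗ[ℤ] periodHomologyHecke N where
  toFun := twistDownFun N hpN hχ hprim
  map_add' φ₁ φ₂ := twist_unique N fun h => by
    simp only [coe_twistDownFun_apply, Submodule.coe_add, LinearMap.add_apply, mul_add]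
  map_smul' n φ := twist_unique N fun h => by
    rw [coe_twistDownFun_apply, RingHom.id_apply, Submodule.coe_smul_of_tower, LinearMap.smul_apply,
      Submodule.coe_smul_of_tower, LinearMap.smul_apply, coe_twistDownFun_apply, zsmul_eq_mul, zsmul_eq_mul]
    ring

/-- **`(T_χ φ)(h) = g(χ)·φ(h_χ)`.** [cite: Stevens1989, Lemma (5.4) p. 97] -/
theorem coe_twistDown_apply (φ : periodHomologyHecke N) (h : CuspForm (Gamma0 N) 2) :
    (twistDown N hpN hχ hprim φ : Module.Dual ℂ (CuspForm (Gamma0 N) 2)) h =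
      gaussSum χ (ZMod.stdAddChar (N := p)) * (φ : Module.Dual ℂ (CuspForm (Gamma0 N) 2)) (charTwist N dvd_rfl hpN hχ h) :=
  coe_twistDownFun_apply N hpN hχ hprim φ h

/-- `T_χ` is characterised by its defining property. [cite: Stevens1989, Lemma (5.4) p. 97] -/
theorem twistDown_eq_of_forall {φ ψ : periodHomologyHecke N}
    (hψ : ∀ h : CuspForm (Gamma0 N) 2, (ψ : Module.Dual ℂ (CuspForm (Gamma0 N) 2)) h =
      gaussSum χ (ZMod.stdAddChar (N := p)) * (φ : Module.Dual ℂ (CuspForm (Gamma0 N) 2)) (charTwist N dvd_rfl hpN hχ h)) :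
    twistDown N hpN hχ hprim φ = ψ :=
  twist_unique N fun h => by rw [coe_twistDown_apply, hψ]

/-- `T_χ{∞, γ∞} = 0` when `c = 0` (`γ∞ = ∞`). [cite: Stevens1989, Lemma (5.4) p. 97] -/
theorem twistDown_symbolInt_of_entry_eq_zero (γ : Gamma0 N) (hc0 : (γ : SL(2, ℤ)) 1 0 = 0) :
    twistDown N hpN hχ hprim (symbolInt N γ) = 0 :=
  twistDown_eq_of_forall N hpN hχ hprim fun h => by
    rw [symbolInt_apply, cuspSymbol, if_pos hc0, mul_zero]
    rfl

/-- The period `1`: `{∞, r + n}_h = {∞, r}_h` for `n ∈ ℤ`, read on `cuspSymbol`: the cusp symbol of `X ∈ Γ₀(N)` only depends on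
`X∞ mod ℤ`. [cite: CremonaAlgorithms1997, §2.1 (2.1.1)] -/
theorem cuspSymbol_eq_modularSymbol_of_cusp (h : CuspForm (Gamma0 N) 2) (X : Gamma0 N) (hX : (X : SL(2, ℤ)) 1 0 ≠ 0)
    (r : ℚ) (n : ℤ) (hr : (((X : SL(2, ℤ)) 0 0 : ℤ) : ℚ) / (((X : SL(2, ℤ)) 1 0 : ℤ) : ℚ) = r + n) :
    cuspSymbol h X = modularSymbol h r := by
  rw [cuspSymbol, if_neg hX, hr, modularSymbol_add_intCast_holds]

include hprim in
/-- **`T_χ{∞, γ∞} = Σ_u χ(u)·{∞, X_u ∞}`** for ANY matrices `X_u ∈ Γ₀(N)` with cusps `X_u∞ ≡ γ∞ + u/p (mod ℤ)`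
(`c ≠ 0`). [cite: Shimura1971, Prop. 3.64; Stevens1989, Lemma (5.4) p. 97] -/
theorem twistDown_symbolInt_eq_sum (γ : Gamma0 N) (hc0 : (γ : SL(2, ℤ)) 1 0 ≠ 0) (X : ZMod p → Gamma0 N)
    (hX : ∀ u, ((X u : SL(2, ℤ)) 1 0) ≠ 0)
    (hcusp : ∀ u, ∃ n : ℤ, ((((X u : SL(2, ℤ)) 0 0 : ℤ) : ℚ) / (((X u : SL(2, ℤ)) 1 0 : ℤ) : ℚ)) =
      (((γ : SL(2, ℤ)) 0 0 : ℤ) : ℚ) / (((γ : SL(2, ℤ)) 1 0 : ℤ) : ℚ) + twistShift u + n) :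
    twistDown N hpN hχ hprim (symbolInt N γ) = ∑ u : ZMod p, quadInt χ u • symbolInt N (X u) :=
  twistDown_eq_of_forall N hpN hχ hprim fun h => by
    rw [symbolInt_apply, gaussSum_mul_cuspSymbol_charTwist N dvd_rfl hpN hχ hprim h γ hc0, Submodule.coe_sum,
      LinearMap.sum_apply]
    refine Finset.sum_congr rfl fun u _ => ?_
    rw [Submodule.coe_smul_of_tower, LinearMap.smul_apply, symbolInt_apply, quadInt_smul χ hχ, smul_eq_mul]
    congr 1
    obtain ⟨n, hn⟩ := hcusp u
    exact cuspSymbol_eq_modularSymbol_of_cusp N h (X u) (hX u) _ n hn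

variable (R : Type) [CommRing R]

/-- **The twisting operator on `H(N; R) = R ⊗ Λ`** (base change of `twistDown`).
[cite: MazurTateTeitelbaum1986, §I.8] -/
def twistDownK : CuspidalHomologyHeckeModule N R →ₗ[R] CuspidalHomologyHeckeModule N R :=
  (twistDown N hpN hχ hprim).baseChange R

/-- `twistDownK (r ⊗ φ) = r ⊗ T_χ φ`. [cite: MazurTateTeitelbaum1986, §I.8] -/
theorem twistDownK_tmul (r : R) (φ : periodHomologyHecke N) :
    twistDownK N hpN hχ hprim R (r ⊗ₜ[ℤ] φ) = r ⊗ₜ[ℤ] twistDown N hpN hχ hprim φ :=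
  LinearMap.baseChange_tmul _ _ _

/-- `twistDownK ({∞, γ∞} ⊗ 1) = 1 ⊗ T_χ{∞, γ∞}`. [cite: MazurTateTeitelbaum1986, §I.8] -/
theorem twistDownK_symbol (γ : Gamma0 N) :
    twistDownK N hpN hχ hprim R (symbol N R γ) = (1 : R) ⊗ₜ[ℤ] twistDown N hpN hχ hprim (symbolInt N γ) := by
  rw [symbol_def, twistDownK_tmul]

/-- `twistDownK ({∞, γ∞} ⊗ 1) = 0` when `c = 0`. [cite: Stevens1989, Lemma (5.4) p. 97] -/
theorem twistDownK_symbol_of_entry_eq_zero (γ : Gamma0 N) (hc0 : (γ : SL(2, ℤ)) 1 0 = 0) :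
    twistDownK N hpN hχ hprim R (symbol N R γ) = 0 := by
  rw [twistDownK_symbol, twistDown_symbolInt_of_entry_eq_zero N hpN hχ hprim γ hc0, TensorProduct.tmul_zero]

include hprim in
/-- **`twistDownK({∞, γ∞} ⊗ 1) = Σ_u χ(u)·({∞, X_u∞} ⊗ 1)`** for matrices `X_u` with cusps `≡ γ∞ + u/p (mod ℤ)`.
[cite: Shimura1971, Prop. 3.64; Stevens1989, Lemma (5.4) p. 97] -/
theorem twistDownK_symbol_eq_sum (γ : Gamma0 N) (hc0 : (γ : SL(2, ℤ)) 1 0 ≠ 0) (X : ZMod p → Gamma0 N)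
    (hX : ∀ u, ((X u : SL(2, ℤ)) 1 0) ≠ 0)
    (hcusp : ∀ u, ∃ n : ℤ, ((((X u : SL(2, ℤ)) 0 0 : ℤ) : ℚ) / (((X u : SL(2, ℤ)) 1 0 : ℤ) : ℚ)) =
      (((γ : SL(2, ℤ)) 0 0 : ℤ) : ℚ) / (((γ : SL(2, ℤ)) 1 0 : ℤ) : ℚ) + twistShift u + n) :
    twistDownK N hpN hχ hprim R (symbol N R γ) = ∑ u : ZMod p, (quadInt χ u : R) • symbol N R (X u) := by
  rw [twistDownK_symbol, twistDown_symbolInt_eq_sum N hpN hχ hprim γ hc0 X hX hcusp, TensorProduct.tmul_sum]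
  refine Finset.sum_congr rfl fun u _ => ?_
  rw [TensorProduct.tmul_smul, ← Int.cast_smul_eq_zsmul R, ← symbol_def]

/-! ### Reading on periods: `Per_f ∘ T_χ = g(χ) · Per_{f_χ}` -/

include hprim in
/-- `g(χ)·w ∈ Λ_f` for `w ∈ Λ_{f_χ}` (the tree's twisting inclusion `g(χ)Λ(f_χ) ⊆ Λ(f)`, Stevens (5.4)).
[cite: Stevens1989, Lemma (5.4) p. 97] -/
theorem gaussSum_mul_mem_periodLattice_of_mem (f : CuspForm (Gamma0 N) 2) {w : ℂ}
    (hw : w ∈ periodLattice (charTwist N dvd_rfl hpN hχ f)) :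
    gaussSum χ (ZMod.stdAddChar (N := p)) * w ∈ periodLattice f := by
  obtain ⟨φ, rfl⟩ := (mem_periodLattice_iff_exists_periodMap N _ w).1 hw
  rw [periodMap_apply, ← coe_twistDown_apply N hpN hχ hprim φ f]
  exact (mem_periodLattice_iff_exists_periodMap N f _).2 ⟨twistDown N hpN hχ hprim φ, rfl⟩

/-- **`Λ_{f_χ} → Λ_f`, `w ↦ g(χ)·w`** as a `ℤ`-linear map. [cite: Stevens1989, Lemma (5.4) p. 97] -/
def gaussMulLattice (f : CuspForm (Gamma0 N) 2) :
    (periodLattice (charTwist N dvd_rfl hpN hχ f)).toIntSubmodule →ₗ[ℤ] (periodLattice f).toIntSubmodule where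
  toFun w := ⟨gaussSum χ (ZMod.stdAddChar (N := p)) * w.1, gaussSum_mul_mem_periodLattice_of_mem N hpN hχ hprim f w.2⟩
  map_add' w₁ w₂ := Subtype.ext (by simp [mul_add])
  map_smul' n w := Subtype.ext (by simp [mul_left_comm])

/-- Unfolding `gaussMulLattice`. [cite: Stevens1989, Lemma (5.4) p. 97] -/
theorem coe_gaussMulLattice (f : CuspForm (Gamma0 N) 2) (w : (periodLattice (charTwist N dvd_rfl hpN hχ f)).toIntSubmodule) :
    (gaussMulLattice N hpN hχ hprim f w : ℂ) = gaussSum χ (ZMod.stdAddChar (N := p)) * (w : ℂ) := rfl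

/-- **`Per_f(T_χ φ) = g(χ)·Per_{f_χ}(φ)`** on `Λ`, with values in `Λ_f`. [cite: Stevens1989, Lemma (5.4) p. 97] -/
theorem periodMapLattice_twistDown (f : CuspForm (Gamma0 N) 2) (φ : periodHomologyHecke N) :
    periodMapLattice N f (twistDown N hpN hχ hprim φ) =
      gaussMulLattice N hpN hχ hprim f (periodMapLattice N (charTwist N dvd_rfl hpN hχ f) φ) := by
  apply Subtype.ext
  rw [coe_periodMapLattice, coe_gaussMulLattice, coe_periodMapLattice, periodMap_apply, periodMap_apply,
    coe_twistDown_apply]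

/-- **`periodClassK f ∘ T_χ = (1 ⊗ g(χ)·) ∘ periodClassK f_χ`** on `H(N; R)`. [cite: Stevens1989, Lemma (5.4) p. 97; CremonaAlgorithms1997, §2.10] -/
theorem periodClassK_twistDownK (f : CuspForm (Gamma0 N) 2) (x : CuspidalHomologyHeckeModule N R) :
    periodClassK N R f (twistDownK N hpN hχ hprim R x) =
      (gaussMulLattice N hpN hχ hprim f).baseChange R (periodClassK N R (charTwist N dvd_rfl hpN hχ f) x) := by
  induction x using TensorProduct.induction_on with
  | zero => simp
  | tmul r φ =>
    rw [twistDownK_tmul, periodClassK_tmul, periodClassK_tmul, LinearMap.baseChange_tmul, periodMapLattice_twistDown]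
  | add x y hx hy => rw [map_add, map_add, hx, hy, map_add, map_add]

end TwistDown

end Literature.NumberTheory.ModularSymbols
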